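import Literature.Computability.Complexity.CodeFPBudgets
import Literature.Algebra.EuclideanLattices.GramSchmidtTableLists
import HarnessLib

/-!
# Cohen's integer Gram–Schmidt table is polynomial time (typed `FP` on codes)

Family `quantum-advantage`, machine side of the discharge of Aaronson–Arkhipov's Thm. 1.3
(`gpeSolvableInFBPPRel_NPRel_of_approxBosonSamplingOracle`): the reduction machine orthonormalises
the columns of its hidden matrix EXACTLY, through Cohen's integer Gram–Schmidt table
(`Algebra/EuclideanLattices/GramSchmidtTableLists.lean`: the list program `gramTable`, `stepTable`,
`levelsOf`, agreeing with `LLLIntegral.uRec` and universally bounded, `abs_tabEntry_tableRec_le`).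
This file proves that list program polynomial-time computable in the typed sense of `CodeFP.lean`,
from the typed leaves of `CodeFPArith.lean` / `CodeFPBudgets.lean` (integers in the difference-pair
code `intE`):

* `dotZ_codeFP` (dot products of coded integer lists, through `CodeFP.intSum` of `CodeFPBudgets.lean`);
* `gramTable_codeFP`, `tabEntry_codeFP`, `stepTable_codeFP`;
* **`levelsOf_codeFP`** — `(1ᴷ, 1^C, rows) ↦ levelsOf rows C K` is typed polynomial time; the one
  estimate is the size of the fold's state along the run, from the universal entry bound
  (`abs_tabEntry_tableRec_le`: `|T_l(i,j)| ≤ B^{l+1}` with `B` the largest squared row norm, and `0`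
  past level `min C |rows|`, `tabEntry_tableRec_eq_zero_of_lt`), i.e. `O((l+1) · |input|)` bits per
  entry.

All proved; no machine is written.

## References

* H. Cohen, *A Course in Computational Algebraic Number Theory*, GTM 138, Springer 1993,
  Algorithm 2.6.7 and §2.6.3 (all quantities are integers of polynomial size).
* S. Arora, B. Barak, *Computational Complexity: A Modern Approach*, CUP 2009, §1.3.
-/

namespace Literature.Computability.QuantumComplexity

open Literature.Computability.Complexity Literature.Computability.Complexity.CodeFP
  Literature.Algebra.EuclideanLattices Polynomial

/-! ### Sizes of integer codes -/

/-- An integer is below `2^{|code|}`. [folklore] -/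
theorem natAbs_lt_two_pow_length_intE (z : ℤ) : z.natAbs < 2 ^ (intE z).length := by
  have h1 : z.toNat < 2 ^ (Computability.encodeNat z.toNat).length := by
    rw [TM2Pass.length_encodeNat_eq_size]; exact Nat.lt_size_self _
  have h2 : (-z).toNat < 2 ^ (Computability.encodeNat (-z).toNat).length := by
    rw [TM2Pass.length_encodeNat_eq_size]; exact Nat.lt_size_self _
  rw [show intE z = Brick.dpEnc z from rfl, Brick.length_dpEnc]
  have habs : z.natAbs = z.toNat + (-z).toNat := by omega
  rw [habs]
  have hA : 2 ^ (Computability.encodeNat z.toNat).length ≤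
      2 ^ (2 * (Computability.encodeNat z.toNat).length + 1) := Nat.pow_le_pow_right (by norm_num) (by omega)
  have hB : 2 ^ (Computability.encodeNat (-z).toNat).length ≤
      2 ^ (2 * (Computability.encodeNat z.toNat).length + 1 + (Computability.encodeNat (-z).toNat).length) :=
    Nat.pow_le_pow_right (by norm_num) (by omega)
  calc z.toNat + (-z).toNat
      < 2 ^ (2 * (Computability.encodeNat z.toNat).length + 1) +
          2 ^ (2 * (Computability.encodeNat z.toNat).length + 1 + (Computability.encodeNat (-z).toNat).length) := by
        omega
    _ ≤ 2 ^ (2 * (Computability.encodeNat z.toNat).length + 2 + (Computability.encodeNat (-z).toNat).length) := by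
        rw [show 2 * (Computability.encodeNat z.toNat).length + 2 + (Computability.encodeNat (-z).toNat).length =
          (2 * (Computability.encodeNat z.toNat).length + 1 + (Computability.encodeNat (-z).toNat).length) + 1 by omega,
          pow_succ]
        have : 2 ^ (2 * (Computability.encodeNat z.toNat).length + 1) ≤
            2 ^ (2 * (Computability.encodeNat z.toNat).length + 1 + (Computability.encodeNat (-z).toNat).length) :=
          Nat.pow_le_pow_right (by norm_num) (by omega)
        omega

/-- An integer below `2^W` has a code of length `≤ 3W + 2`. [folklore] -/
theorem length_intE_le_of_natAbs_lt {z : ℤ} {W : ℕ} (h : z.natAbs < 2 ^ W) : (intE z).length ≤ 3 * W + 2 := by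
  have hs : z.natAbs.size ≤ W := Nat.size_le.2 h
  have := Brick.length_dpEnc_le z
  change (Brick.dpEnc z).length ≤ _
  omega

/-- A raw list code with items of length `≤ E` has length `≤ |l| (2E + 2)` (a twin of
`LMat.length_rawE_le_mul` of `AOWListMatrixFP.lean`, which lies outside this file's import cone).
[folklore] -/
theorem length_rawE_le_of_forall {α : Type} (e : α → List Bool) {l : List α} {E : ℕ}
    (h : ∀ a ∈ l, (e a).length ≤ E) : (rawE e l).length ≤ l.length * (2 * E + 2) := by
  induction l with
  | nil => simp
  | cons a l ih =>
    rw [rawE_cons, length_boolPair, List.length_cons]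
    have h1 := h a (by simp)
    have h2 := ih fun b hb => h b (List.mem_cons_of_mem _ hb)
    nlinarith

/-! ### Dot products -/

/-- **Dot products are typed polynomial time.** [folklore] -/
theorem dotZ_codeFP : CodeFP (pairE (rawE intE) (rawE intE)) intE (fun p => dotZ p.1 p.2) := by
  have hz : CodeFP (pairE unitE (pairE (rawE intE) (rawE intE))) (rawE intE)
      (fun p => List.zipWith (fun a b => a * b) p.2.1 p.2.2) := by
    exact (zipWith (σ := Unit) (eσ := unitE) (g := fun t => t.2.1 * t.2.2)
      (intMul.comp ((snd _ _).fst'.pair (snd _ _).snd')) :)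
  exact ((intSum.comp (hz.comp ((const _ ()).pair (CodeFP.id _)))).congr fun p => rfl :)

/-! ### The Gram table and one level -/

/-- **The Gram table is typed polynomial time**: `(1^C, rows) ↦ gramTable rows C`. [folklore] -/
theorem gramTable_codeFP : CodeFP (pairE unE (rawE (rawE intE))) (rawE (rawE intE)) (fun p => gramTable p.2 p.1) := by
  -- inner: context `ri`, item `rj`
  have hinner : CodeFP (pairE (rawE intE) (rawE (rawE intE))) (rawE intE)
      (fun q => q.2.map fun rj => dotZ q.1 rj) := by
    exact (map (σ := List ℤ) (g := fun t => dotZ t.1 t.2) dotZ_codeFP :)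
  -- outer: context `rows.take C`, item `ri`
  have houter : CodeFP (pairE (rawE (rawE intE)) (rawE (rawE intE))) (rawE (rawE intE))
      (fun q => q.2.map fun ri => q.1.map fun rj => dotZ ri rj) := by
    exact (map (σ := List (List ℤ)) (g := fun t => t.1.map fun rj => dotZ t.2 rj)
      (hinner.comp ((snd _ _).pair (fst _ _))) :)
  have htake : CodeFP (pairE unE (rawE (rawE intE))) (rawE (rawE intE)) (fun p => p.2.take p.1) := rawTakeUn _
  exact ((houter.comp (htake.pair (snd _ _))).congr fun p => rfl :)

/-- Table entries are typed polynomial time: `(T, i, j) ↦ tabEntry T i j`. [folklore] -/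
theorem tabEntry_codeFP : CodeFP (pairE (rawE (rawE intE)) (pairE natE natE)) intE
    (fun p => tabEntry p.1 p.2.1 p.2.2) := by
  have hrow : CodeFP (pairE (rawE (rawE intE)) (pairE natE natE)) (rawE intE) (fun p => p.1.getD p.2.1 []) := by
    exact ((rawGetD (rawE intE) (d := ([] : List ℤ)) rfl).comp ((fst _ _).pair (snd _ _).fst') :)
  exact ((rawGetOr intE).comp (hrow.pair ((snd _ _).snd'.pair (const _ (0 : ℤ)))) :)

/-- `(T, l) ↦` the column `l` of the table (`r.getD l 0` row by row). [folklore] -/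
theorem column_codeFP : CodeFP (pairE (rawE (rawE intE)) natE) (rawE intE)
    (fun p => p.1.map fun r => r.getD p.2 0) := by
  have hitem : CodeFP (pairE natE (rawE intE)) intE (fun t => t.2.getD t.1 0) := by
    exact ((rawGetOr intE).comp ((snd _ _).pair ((fst _ _).pair (const _ (0 : ℤ)))) :)
  exact ((map hitem).comp ((snd _ _).pair (fst _ _)) :)

/-- The new entry of one level: `((pll, colL, d, rowl), (j, x)) ↦ (pll · x - colL[j] · rowl) / d`.
[folklore] -/
def stepEntry (t : (ℤ × List ℤ × ℤ × ℤ) × (ℕ × ℤ)) : ℤ :=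
  (t.1.1 * t.2.2 - t.1.2.1.getD t.2.1 0 * t.1.2.2.2) / t.1.2.2.1

/-- `stepEntry` is typed polynomial time. [folklore] -/
theorem stepEntry_codeFP :
    CodeFP (pairE (pairE intE (pairE (rawE intE) (pairE intE intE))) (pairE natE intE)) intE stepEntry := by
  have hpll : CodeFP (pairE (pairE intE (pairE (rawE intE) (pairE intE intE))) (pairE natE intE)) intE
      (fun t => t.1.1) := (fst _ _).fst'
  have hx : CodeFP (pairE (pairE intE (pairE (rawE intE) (pairE intE intE))) (pairE natE intE)) intE
      (fun t => t.2.2) := (snd _ _).snd'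
  have hcol : CodeFP (pairE (pairE intE (pairE (rawE intE) (pairE intE intE))) (pairE natE intE)) intE
      (fun t => t.1.2.1.getD t.2.1 0) := by
    exact ((rawGetOr intE).comp ((fst _ _).snd'.fst'.pair ((snd _ _).fst'.pair (const _ (0 : ℤ)))) :)
  have hrowl : CodeFP (pairE (pairE intE (pairE (rawE intE) (pairE intE intE))) (pairE natE intE)) intE
      (fun t => t.1.2.2.2) := (fst _ _).snd'.snd'.snd'
  have hd : CodeFP (pairE (pairE intE (pairE (rawE intE) (pairE intE intE))) (pairE natE intE)) intE
      (fun t => t.1.2.2.1) := (fst _ _).snd'.snd'.fst'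
  have h1 : CodeFP (pairE (pairE intE (pairE (rawE intE) (pairE intE intE))) (pairE natE intE)) intE
      (fun t => t.1.1 * t.2.2) := by exact (intMul.comp (hpll.pair hx) :)
  have h2 : CodeFP (pairE (pairE intE (pairE (rawE intE) (pairE intE intE))) (pairE natE intE)) intE
      (fun t => t.1.2.1.getD t.2.1 0 * t.1.2.2.2) := by exact (intMul.comp (hcol.pair hrowl) :)
  have h3 : CodeFP (pairE (pairE intE (pairE (rawE intE) (pairE intE intE))) (pairE natE intE)) intE
      (fun t => t.1.1 * t.2.2 - t.1.2.1.getD t.2.1 0 * t.1.2.2.2) := by exact (intSub.comp (h1.pair h2) :)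
  exact (intEDiv.comp (h3.pair hd) :)

/-- **One level is typed polynomial time**: `(l, d, T) ↦ stepTable l d T`. [cite: Cohen1993, Algorithm 2.6.7 (Step 2)] -/
theorem stepTable_codeFP : CodeFP (pairE natE (pairE intE (rawE (rawE intE)))) (rawE (rawE intE))
    (fun p => stepTable p.1 p.2.1 p.2.2) := by
  -- the context of the outer map: `(pll, colL, d, l)`; of the inner map: `(pll, colL, d, rowl)`
  -- inner map over the enumerated row
  have hinner : CodeFP (pairE (pairE intE (pairE (rawE intE) (pairE intE intE))) (rawE (pairE natE intE))) (rawE intE)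
      (fun q => q.2.map fun a => stepEntry (q.1, a)) := by
    exact (map (g := stepEntry) stepEntry_codeFP :)
  -- the row function: context `(pll, colL, d, l)`, item `row`
  have hrowCtx : CodeFP (pairE (pairE intE (pairE (rawE intE) (pairE intE natE))) (rawE intE))
      (pairE intE (pairE (rawE intE) (pairE intE intE)))
      (fun q => (q.1.1, q.1.2.1, q.1.2.2.1, q.2.getD q.1.2.2.2 0)) := by
    have hrowl : CodeFP (pairE (pairE intE (pairE (rawE intE) (pairE intE natE))) (rawE intE)) intE
        (fun q => q.2.getD q.1.2.2.2 0) := by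
      exact ((rawGetOr intE).comp ((snd _ _).pair ((fst _ _).snd'.snd'.snd'.pair (const _ (0 : ℤ)))) :)
    exact ((fst _ _).fst'.pair ((fst _ _).snd'.fst'.pair ((fst _ _).snd'.snd'.fst'.pair hrowl)) :)
  have hrowFn : CodeFP (pairE (pairE intE (pairE (rawE intE) (pairE intE natE))) (rawE intE)) (rawE intE)
      (fun q => ((List.range q.2.length).zip q.2).map fun a =>
        stepEntry ((q.1.1, q.1.2.1, q.1.2.2.1, q.2.getD q.1.2.2.2 0), a)) := by
    exact (hinner.comp (hrowCtx.pair ((rawEnum intE).comp (snd _ _))) :)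
  have houter : CodeFP (pairE (pairE intE (pairE (rawE intE) (pairE intE natE))) (rawE (rawE intE))) (rawE (rawE intE))
      (fun q => q.2.map fun row => ((List.range row.length).zip row).map fun a =>
        stepEntry ((q.1.1, q.1.2.1, q.1.2.2.1, row.getD q.1.2.2.2 0), a)) := by
    exact (map hrowFn :)
  -- assemble the context from `(l, d, T)`
  have hT : CodeFP (pairE natE (pairE intE (rawE (rawE intE)))) (rawE (rawE intE)) (fun p => p.2.2) := (snd _ _).snd'
  have hl : CodeFP (pairE natE (pairE intE (rawE (rawE intE)))) natE (fun p => p.1) := fst _ _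
  have hd : CodeFP (pairE natE (pairE intE (rawE (rawE intE)))) intE (fun p => p.2.1) := (snd _ _).fst'
  have hpll : CodeFP (pairE natE (pairE intE (rawE (rawE intE)))) intE (fun p => tabEntry p.2.2 p.1 p.1) := by
    exact (tabEntry_codeFP.comp (hT.pair (hl.pair hl)) :)
  have hcolL : CodeFP (pairE natE (pairE intE (rawE (rawE intE)))) (rawE intE)
      (fun p => p.2.2.map fun r => r.getD p.1 0) := by
    exact (column_codeFP.comp (hT.pair hl) :)
  have hctx : CodeFP (pairE natE (pairE intE (rawE (rawE intE))))
      (pairE (pairE intE (pairE (rawE intE) (pairE intE natE))) (rawE (rawE intE)))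
      (fun p => ((tabEntry p.2.2 p.1 p.1, p.2.2.map fun r => r.getD p.1 0, p.2.1, p.1), p.2.2)) := by
    exact ((hpll.pair (hcolL.pair (hd.pair hl))).pair hT :)
  refine ((houter.comp hctx).congr fun p => ?_ :)
  rfl

/-! ### The level fold -/

/-- Past level `min C |rows|` every table entry is `0`. [folklore] -/
theorem tabEntry_tableRec_eq_zero_of_lt (rows : List (List ℤ)) (C : ℕ) {l : ℕ} (hl : min C rows.length < l)
    (i j : ℕ) : tabEntry (tableRec rows C l) i j = 0 := by
  obtain ⟨l', rfl⟩ : ∃ l', l = l' + 1 := ⟨l - 1, by omega⟩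
  have hl' : min C rows.length ≤ l' := by omega
  by_cases hi : i < rows.length
  · by_cases hj : j < min C rows.length
    · rw [tableRec_succ, tabEntry_stepTable l' _ _ (by rw [length_tableRec]; exact hi)
        (by rw [length_of_mem_tableRec rows C l' (List.getElem_mem _)]; exact hj)]
      have h1 : tabEntry (tableRec rows C l') l' l' = 0 := tabEntry_eq_zero_of_le rows C l' (Or.inr hl')
      have h2 : tabEntry (tableRec rows C l') i l' = 0 := tabEntry_eq_zero_of_le rows C l' (Or.inr hl')
      rw [h1, h2]; simp
    · exact tabEntry_eq_zero_of_le rows C _ (Or.inr (not_lt.1 hj))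
  · exact tabEntry_eq_zero_of_le rows C _ (Or.inl (not_lt.1 hi))

/-- The padded rows have squared norm `≤ |rows code| · 4^{|rows code|}`. [folklore] -/
theorem norm_padFamily_sq_le (rows : List (List ℤ)) (k : Fin rows.length) :
    ‖(⇑(intVecToEuclidean (maxWidth rows)).toAddMonoidHom ∘ padFamily rows (maxWidth rows)) k‖ ^ 2 ≤
      (rawE (rawE intE) rows).length * (4 : ℝ) ^ (rawE (rawE intE) rows).length := by
  set R := (rawE (rawE intE) rows).length with hR
  rw [norm_padFamily_sq]
  have hrow : rows[k] ∈ rows := List.getElem_mem _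
  have hitem : ∀ t : Fin (maxWidth rows), (((rows[k]).getD t 0 : ℝ)) ^ 2 ≤ (4 : ℝ) ^ R := by
    intro t
    by_cases ht : (t : ℕ) < (rows[k]).length
    · rw [List.getD_eq_getElem _ _ ht]
      have hmem : (rows[k])[(t : ℕ)] ∈ rows[k] := List.getElem_mem _
      have h1 := natAbs_lt_two_pow_length_intE ((rows[k])[(t : ℕ)])
      have h2 : (intE ((rows[k])[(t : ℕ)])).length ≤ R := by
        have := length_item_le_length_rawE intE hmem
        have := length_item_le_length_rawE (rawE intE) hrow
        omega
      have h3 : ((rows[k])[(t : ℕ)]).natAbs < 2 ^ R := h1.trans_le (Nat.pow_le_pow_right (by norm_num) h2)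
      have h4 : |(((rows[k])[(t : ℕ)] : ℤ) : ℝ)| < (2 : ℝ) ^ R := by
        rw [← Int.cast_abs, Int.abs_eq_natAbs]; exact_mod_cast h3
      calc (((rows[k])[(t : ℕ)] : ℤ) : ℝ) ^ 2 = |(((rows[k])[(t : ℕ)] : ℤ) : ℝ)| ^ 2 := (sq_abs _).symm
        _ ≤ ((2 : ℝ) ^ R) ^ 2 := pow_le_pow_left₀ (abs_nonneg _) h4.le 2
        _ = (4 : ℝ) ^ R := by rw [← pow_mul, mul_comm, pow_mul]; norm_num
    · rw [List.getD_eq_default _ _ (not_lt.1 ht)]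
      simp only [Int.cast_zero, ne_eq, OfNat.ofNat_ne_zero, not_false_eq_true, zero_pow]
      positivity
  have hD : maxWidth rows ≤ R := by
    -- every row length is at most the code length
    unfold maxWidth
    suffices ∀ L : List (List ℤ), (∀ r ∈ L, r.length ≤ R) → (L.map List.length).foldr max 0 ≤ R from
      this rows fun r hr => (length_le_length_rawE intE r).trans
        (by have := length_item_le_length_rawE (rawE intE) hr; omega)
    intro L hL
    induction L with
    | nil => simp
    | cons a L ih =>
      rw [List.map_cons, List.foldr_cons]
      exact max_le (hL a (by simp)) (ih fun r hr => hL r (List.mem_cons_of_mem _ hr))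
  calc ∑ t : Fin (maxWidth rows), (((rows[k]).getD t 0 : ℝ)) ^ 2 ≤ ∑ _t : Fin (maxWidth rows), (4 : ℝ) ^ R :=
        Finset.sum_le_sum fun t _ => hitem t
    _ = maxWidth rows * (4 : ℝ) ^ R := by simp
    _ ≤ R * (4 : ℝ) ^ R := by gcongr

/-- **Every entry of every level is short**: `|T_l(i,j)| < 2^{3 R (l+1)}` with `R` the length of the
code of the rows (all levels, all indices, every input). [folklore] -/
theorem natAbs_tabEntry_tableRec_lt (rows : List (List ℤ)) (C l i j : ℕ) :
    (tabEntry (tableRec rows C l) i j).natAbs < 2 ^ (3 * (rawE (rawE intE) rows).length * (l + 1) + 1) := by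
  set R := (rawE (rawE intE) rows).length with hR
  by_cases hl : l ≤ min C rows.length
  · have hB := norm_padFamily_sq_le rows
    set B : ℝ := max 1 (R * (4 : ℝ) ^ R) with hBdef
    have hB' : ∀ k : Fin rows.length,
        ‖(⇑(intVecToEuclidean (maxWidth rows)).toAddMonoidHom ∘ padFamily rows (maxWidth rows)) k‖ ^ 2 ≤ B :=
      fun k => (hB k).trans (le_max_right _ _)
    have h := abs_tabEntry_tableRec_le rows C le_rfl hB' (le_trans zero_le_one (le_max_left _ _)) hl i j
    -- `B ≤ 2^{3R}` hence `B^{l+1} ≤ 2^{3R(l+1)}`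
    have hB2 : B ≤ (2 : ℝ) ^ (3 * R) := by
      refine max_le (one_le_pow₀ (by norm_num)) ?_
      have hR2 : (R : ℝ) ≤ (2 : ℝ) ^ R := by exact_mod_cast Nat.lt_two_pow_self.le
      calc (R : ℝ) * (4 : ℝ) ^ R ≤ (2 : ℝ) ^ R * (4 : ℝ) ^ R := by gcongr
        _ = (2 : ℝ) ^ (3 * R) := by
          rw [show (4 : ℝ) = 2 ^ 2 by norm_num, ← pow_mul, ← pow_add]; ring_nf
    have hpow : B ^ (l + 1) ≤ (2 : ℝ) ^ (3 * R * (l + 1)) := by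
      rw [pow_mul]; exact pow_le_pow_left₀ (le_trans zero_le_one (le_max_left _ _)) hB2 _
    have hreal : |((tabEntry (tableRec rows C l) i j : ℤ) : ℝ)| < (2 : ℝ) ^ (3 * R * (l + 1) + 1) := by
      calc |((tabEntry (tableRec rows C l) i j : ℤ) : ℝ)| ≤ (2 : ℝ) ^ (3 * R * (l + 1)) := h.trans hpow
        _ < (2 : ℝ) ^ (3 * R * (l + 1) + 1) := pow_lt_pow_right₀ (by norm_num) (by omega)
    rw [← Int.cast_abs, Int.abs_eq_natAbs] at hreal
    exact_mod_cast hreal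
  · rw [tabEntry_tableRec_eq_zero_of_lt rows C (not_le.1 hl)]
    simp

/-- The `d`'s are short: `|d_l| < 2^{3 R l + 1}`. [folklore] -/
theorem natAbs_dList_lt (rows : List (List ℤ)) (C l : ℕ) :
    (dList rows C l).natAbs < 2 ^ (3 * (rawE (rawE intE) rows).length * (l + 1) + 1) := by
  cases l with
  | zero => rw [dList_zero]; simp
  | succ l =>
    rw [dList_succ]
    exact (natAbs_tabEntry_tableRec_lt rows C l l l).trans_le (Nat.pow_le_pow_right (by norm_num) (by nlinarith))

/-- The code of a table all of whose entries are below `2^W`. [folklore] -/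
theorem length_tableCode_le {T : List (List ℤ)} {W N Cw : ℕ} (hN : T.length ≤ N) (hC : ∀ row ∈ T, row.length ≤ Cw)
    (hW : ∀ row ∈ T, ∀ z ∈ row, z.natAbs < 2 ^ W) :
    (rawE (rawE intE) T).length ≤ N * (2 * (Cw * (2 * (3 * W + 2) + 2)) + 2) := by
  have hrow : ∀ row ∈ T, (rawE intE row).length ≤ Cw * (2 * (3 * W + 2) + 2) := fun row hrow =>
    (length_rawE_le_of_forall intE fun z hz => length_intE_le_of_natAbs_lt (hW row hrow z hz)).trans
      (Nat.mul_le_mul_right _ (hC row hrow))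
  exact (length_rawE_le_of_forall (rawE intE) hrow).trans (Nat.mul_le_mul_right _ hN)

/-- The size of the table at level `l`: a polynomial in the code length `R` of the rows and `l`.
[folklore] -/
theorem length_tableRec_code_le (rows : List (List ℤ)) (C l : ℕ) :
    (rawE (rawE intE) (tableRec rows C l)).length ≤
      (rawE (rawE intE) rows).length *
        (2 * ((rawE (rawE intE) rows).length * (2 * (3 * (3 * (rawE (rawE intE) rows).length * (l + 1) + 1) + 2) + 2)) + 2) := by
  set R := (rawE (rawE intE) rows).length with hR
  have hN : (tableRec rows C l).length ≤ R := by
    rw [length_tableRec]; exact length_le_length_rawE _ _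
  have hC : ∀ row ∈ tableRec rows C l, row.length ≤ R := fun row hrow => by
    rw [length_of_mem_tableRec rows C l hrow]
    exact (min_le_right _ _).trans (length_le_length_rawE _ _)
  refine length_tableCode_le hN hC fun row hrow z hz => ?_
  obtain ⟨i, hi, rfl⟩ := List.mem_iff_getElem.1 hrow
  obtain ⟨j, hj, rfl⟩ := List.mem_iff_getElem.1 hz
  have := natAbs_tabEntry_tableRec_lt rows C l i j
  rwa [tabEntry_eq_getElem _ hi hj] at this

/-- The code of the fold's state `(l, d, T, acc)`. [folklore] -/
abbrev gsStateE : ℕ × ℤ × List (List ℤ) × List (ℤ × List (List ℤ)) → List Bool :=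
  pairE natE (pairE intE (pairE (rawE (rawE intE)) (rawE (pairE intE (rawE (rawE intE))))))

/-- The code of the fold's context `(1^C, rows)`. [folklore] -/
abbrev gsCtxE : ℕ × List (List ℤ) → List Bool := pairE unE (rawE (rawE intE))

/-- The code of the fold's step argument `(context, unit, state)`. [folklore] -/
abbrev gsStepE : (ℕ × List (List ℤ)) × Unit × (ℕ × ℤ × List (List ℤ) × List (ℤ × List (List ℤ))) → List Bool :=
  pairE gsCtxE (pairE unitE gsStateE)

/-- The step of the level fold is typed polynomial time. [folklore] -/
theorem levelStep_codeFP : CodeFP gsStepE gsStateE (fun t => levelStep t.2.2 t.2.1) := by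
  have hst : CodeFP gsStepE gsStateE (fun t => t.2.2) := (snd _ _).snd'
  have hl : CodeFP gsStepE natE (fun t => t.2.2.1) := hst.fst'
  have hd : CodeFP gsStepE intE (fun t => t.2.2.2.1) := hst.snd'.fst'
  have hT : CodeFP gsStepE (rawE (rawE intE)) (fun t => t.2.2.2.2.1) := hst.snd'.snd'.fst'
  have hacc : CodeFP gsStepE (rawE (pairE intE (rawE (rawE intE)))) (fun t => t.2.2.2.2.2) := hst.snd'.snd'.snd'
  have h1 : CodeFP gsStepE natE (fun t => t.2.2.1 + 1) := by
    exact (natAdd.comp (hl.pair (const gsStepE (1 : ℕ))) :)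
  have h2 : CodeFP gsStepE intE (fun t => tabEntry t.2.2.2.2.1 t.2.2.1 t.2.2.1) := by
    exact (tabEntry_codeFP.comp (hT.pair (hl.pair hl)) :)
  have h3 : CodeFP gsStepE (rawE (rawE intE)) (fun t => stepTable t.2.2.1 t.2.2.2.1 t.2.2.2.2.1) := by
    exact (stepTable_codeFP.comp (hl.pair (hd.pair hT)) :)
  have h4 : CodeFP gsStepE (rawE (pairE intE (rawE (rawE intE))))
      (fun t => t.2.2.2.2.2 ++ [(t.2.2.2.1, t.2.2.2.2.1)]) := by
    exact ((rawAppend (pairE intE (rawE (rawE intE)))).comp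
      (hacc.pair ((rawSingleton (pairE intE (rawE (rawE intE)))).comp (hd.pair hT))) :)
  exact (h1.pair (h2.pair (h3.pair h4)) :)

/-- The initial state of the level fold is typed polynomial time. [folklore] -/
theorem levelInit_codeFP : CodeFP gsCtxE gsStateE
    (fun s => ((0 : ℕ), (1 : ℤ), gramTable s.2 s.1, ([] : List (ℤ × List (List ℤ))))) := by
  exact ((const gsCtxE (0 : ℕ)).pair ((const gsCtxE (1 : ℤ)).pair
    (gramTable_codeFP.pair (const gsCtxE ([] : List (ℤ × List (List ℤ)))))) :)

/-- Monotonicity of `c · Mᵏ` in the exponent, for `M ≥ 1`. [folklore] -/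
theorem le_mul_pow_of_le {a c k j M : ℕ} (hM : 1 ≤ M) (h : a ≤ c * M ^ k) (hj : k ≤ j) : a ≤ c * M ^ j :=
  h.trans (Nat.mul_le_mul_left _ (Nat.pow_le_pow_right hM hj))

/-- **The size of the fold's state along the run** is polynomial in the input length:
the one estimate of the construction (`≤ 280 (n₀ + 1)⁵`). [folklore] -/
theorem length_levelState_le (C : ℕ) (rows : List (List ℤ)) (l₁ l₂ : List Unit) :
    (gsStateE (l₁.foldl (fun st u => levelStep st u) ((0 : ℕ), (1 : ℤ), gramTable rows C, []))).length ≤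
      (280 * (X + 1) ^ 5 : Polynomial ℕ).eval (pairE gsCtxE (rawE unitE) ((C, rows), l₁ ++ l₂)).length := by
  have hrun : l₁.foldl (fun st u => levelStep st u) ((0 : ℕ), (1 : ℤ), gramTable rows C, []) =
      (l₁.length, dList rows C l₁.length, tableRec rows C l₁.length,
        (List.range l₁.length).map fun i => (dList rows C i, tableRec rows C i)) := by
    have h := foldl_levelStep rows C l₁.length [] 0
    simp only [Nat.zero_add, List.nil_append] at h
    conv_lhs => rw [show l₁ = List.replicate l₁.length () from List.eq_replicate_iff.2 ⟨rfl, fun u _ => rfl⟩]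
    exact h
  rw [hrun, eval_mul, eval_pow, eval_add, eval_X, eval_one, eval_ofNat]
  -- the input length `n₀`; `M = n₀ + 1`; `R ≤ n₀`, `t ≤ n₀`
  set n₀ := (pairE gsCtxE (rawE unitE) ((C, rows), l₁ ++ l₂)).length with hn₀
  set M := n₀ + 1 with hM
  have hM1 : 1 ≤ M := by omega
  have hRn : (rawE (rawE intE) rows).length ≤ n₀ := by
    rw [hn₀]; simp only [gsCtxE, pairE_apply, length_boolPair]; omega
  have htn : l₁.length ≤ n₀ := by
    rw [hn₀]; simp only [pairE_apply, length_boolPair]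
    have : l₁.length ≤ (rawE unitE (l₁ ++ l₂)).length :=
      le_trans (by simp) (length_le_length_rawE unitE (l₁ ++ l₂))
    omega
  have hRM : (rawE (rawE intE) rows).length ≤ M := by omega
  have htM : l₁.length ≤ M := by omega
  -- entry width at levels `i ≤ t`: `3 R (i+1) + 1 ≤ 3 M²`
  have hW : ∀ i ≤ l₁.length, 3 * (rawE (rawE intE) rows).length * (i + 1) + 1 ≤ 3 * M ^ 2 := by
    intro i hi
    have h1 : (rawE (rawE intE) rows).length * (i + 1) ≤ n₀ * M := Nat.mul_le_mul hRn (by omega)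
    have h2 : 3 * (n₀ * M) + 1 ≤ 3 * M ^ 2 := by rw [hM]; ring_nf; omega
    calc 3 * (rawE (rawE intE) rows).length * (i + 1) + 1 = 3 * ((rawE (rawE intE) rows).length * (i + 1)) + 1 := by ring
      _ ≤ 3 * (n₀ * M) + 1 := by omega
      _ ≤ 3 * M ^ 2 := h2
  -- code of an entry / of a `d` at level `i ≤ t`: `≤ 11 M²`
  have hent : ∀ i ≤ l₁.length, ∀ a b : ℕ, (intE (tabEntry (tableRec rows C i) a b)).length ≤ 11 * M ^ 2 := by
    intro i hi a b
    have := length_intE_le_of_natAbs_lt (natAbs_tabEntry_tableRec_lt rows C i a b)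
    have := hW i hi
    omega
  have hdl : ∀ i ≤ l₁.length, (intE (dList rows C i)).length ≤ 11 * M ^ 2 := by
    intro i hi
    have := length_intE_le_of_natAbs_lt (natAbs_dList_lt rows C i)
    have := hW i hi
    omega
  have hM2 : M ≤ M ^ 2 := by nlinarith
  have hM3 : M ≤ M ^ 3 := by nlinarith
  have hM4 : M ≤ M ^ 4 := by nlinarith
  -- code of a table at level `i ≤ t`: `≤ 50 M⁴`
  have htab : ∀ i ≤ l₁.length, (rawE (rawE intE) (tableRec rows C i)).length ≤ 50 * M ^ 4 := by
    intro i hi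
    have hrow : ∀ row ∈ tableRec rows C i, (rawE intE row).length ≤ 24 * M ^ 3 := by
      intro row hrow
      obtain ⟨a, ha, rfl⟩ := List.mem_iff_getElem.1 hrow
      have h1 : (rawE intE (tableRec rows C i)[a]).length ≤ ((tableRec rows C i)[a]).length * (2 * (11 * M ^ 2) + 2) :=
        length_rawE_le_of_forall intE fun z hz => by
          obtain ⟨b, hb, rfl⟩ := List.mem_iff_getElem.1 hz
          rw [← tabEntry_eq_getElem _ ha hb]
          exact hent i hi a b
      have h2 : ((tableRec rows C i)[a]).length ≤ M := by
        rw [length_of_mem_tableRec rows C i hrow]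
        exact (min_le_right _ _).trans ((length_le_length_rawE _ _).trans hRM)
      have h3 : M * (2 * (11 * M ^ 2) + 2) ≤ 24 * M ^ 3 := by
        have : M * (2 * (11 * M ^ 2) + 2) = 22 * M ^ 3 + 2 * M := by ring
        rw [this]; omega
      exact h1.trans ((Nat.mul_le_mul_right _ h2).trans h3)
    have h1 := length_rawE_le_of_forall (rawE intE) hrow
    have h2 : (tableRec rows C i).length ≤ M := by
      rw [length_tableRec]; exact (length_le_length_rawE _ _).trans hRM
    have h3 : M * (2 * (24 * M ^ 3) + 2) ≤ 50 * M ^ 4 := by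
      have : M * (2 * (24 * M ^ 3) + 2) = 48 * M ^ 4 + 2 * M := by ring
      rw [this]; omega
    exact h1.trans ((Nat.mul_le_mul_right _ h2).trans h3)
  -- the accumulated list: `≤ 150 M⁵`
  have hacc : (rawE (pairE intE (rawE (rawE intE)))
      ((List.range l₁.length).map fun i => (dList rows C i, tableRec rows C i))).length ≤ 150 * M ^ 5 := by
    have h1 := length_rawE_le_of_forall (pairE intE (rawE (rawE intE)))
      (l := (List.range l₁.length).map fun i => (dList rows C i, tableRec rows C i))
      (E := 2 * (11 * M ^ 2) + 2 + 50 * M ^ 4) fun q hq => by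
        obtain ⟨i, hi, rfl⟩ := List.mem_map.1 hq
        rw [List.mem_range] at hi
        simp only [pairE_apply, length_boolPair]
        have := hdl i hi.le; have := htab i hi.le
        omega
    rw [List.length_map, List.length_range] at h1
    have hM5 : M ≤ M ^ 5 := by nlinarith
    have hM25 : M ^ 3 ≤ M ^ 5 := Nat.pow_le_pow_right hM1 (by norm_num)
    have h2 : M * (2 * (2 * (11 * M ^ 2) + 2 + 50 * M ^ 4) + 2) ≤ 150 * M ^ 5 := by
      have : M * (2 * (2 * (11 * M ^ 2) + 2 + 50 * M ^ 4) + 2) = 100 * M ^ 5 + 44 * M ^ 3 + 6 * M := by ring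
      rw [this]; omega
    exact h1.trans ((Nat.mul_le_mul_right _ htM).trans h2)
  have hnat : (natE l₁.length).length ≤ M := (length_natE_le _).trans htM
  simp only [gsStateE, pairE_apply, length_boolPair]
  have e1 := hdl l₁.length le_rfl
  have e2 := htab l₁.length le_rfl
  have p1 : M ≤ M ^ 5 := by nlinarith
  have p2 : M ^ 2 ≤ M ^ 5 := Nat.pow_le_pow_right hM1 (by norm_num)
  have p4 : M ^ 4 ≤ M ^ 5 := Nat.pow_le_pow_right hM1 (by norm_num)
  have p0 : 1 ≤ M ^ 5 := Nat.one_le_pow _ _ hM1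
  omega

/-- **The level fold is typed polynomial time**: `(1ᴷ, 1^C, rows) ↦ levelsOf rows C K`.
[cite: Cohen1993, Algorithm 2.6.7] -/
theorem levelsOf_codeFP : CodeFP (pairE unE (pairE unE (rawE (rawE intE)))) (rawE (pairE intE (rawE (rawE intE))))
    (fun p => levelsOf p.2.2 p.2.1 p.1) := by
  have hfold := foldl (σ := ℕ × List (List ℤ)) (α := Unit) (eσ := gsCtxE) (eα := unitE) (eβ := gsStateE)
    (step := fun s u st => levelStep st u) (init := fun s => ((0 : ℕ), (1 : ℤ), gramTable s.2 s.1, []))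
    levelStep_codeFP levelInit_codeFP (280 * (X + 1) ^ 5)
    (fun s l₁ l₂ => length_levelState_le s.1 s.2 l₁ l₂)
  -- assemble: `(K, C, rows) ↦ ((C, rows), replicate K ())`
  have hK : CodeFP (pairE unE (pairE unE (rawE (rawE intE)))) (rawE unitE) (fun p => List.replicate p.1 ()) := by
    exact (replicateUnit.comp (fst _ _) :)
  have hσ : CodeFP (pairE unE (pairE unE (rawE (rawE intE)))) gsCtxE (fun p => (p.2.1, p.2.2)) := by
    exact ((snd _ _).fst'.pair (snd _ _).snd' :)
  refine (((hfold.comp (hσ.pair hK)).snd'.snd'.snd').congr fun p => ?_ :)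
  rfl

end Literature.Computability.QuantumComplexity
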